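import Summits.ABC.StewartYu.WeightedLatticeBasis
import Literature.NumberTheory.DiophantineGeometry.SmallMultiplicativeRelation
import Mathlib.LinearAlgebra.Matrix.NonsingularInverse
import Mathlib.LinearAlgebra.Matrix.Adjugate
import HarnessLib

/-!
# Matveev's lattice lever, place-free part I: short independent vectors in a sublattice of `ℤⁿ`
# for the weighted `ℓ¹` norm (Minkowski II in basis coordinates + the maximal weighted minor)

Cell topic `Summits/ABC/StewartYu` (cell abc-stewartyu, lit seat g5); namespace
`Summit.ABC.StewartYu.LatticeLever`; theorems only.  This is the geometry-of-numbers half of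
the END of the Gen-3 (Matveev / Nesterenko 2003 / Yu 2007) engines for linear forms in logarithms,
in the form both printed packagings consume (HOME/lit/SOURCES.md §18.5, §20.3):

* Nesterenko 2003, Prop. 2.6 with (5.19)–(5.21): for a sublattice `Φ = ℤa₁ + ⋯ + ℤa_r ⊂ ℤⁿ` and the
  norm `‖x‖_A = ∑ₖ Aₖ|xₖ|`, the successive minima give independent `z₁, …, z_r ∈ Φ` with
  `∏ ‖zₖ‖_A ≤ 2^r V(Φ)/V(𝔎)` and `V(Φ)/V(𝔎) ≤ c(n,r) · ∑_I |det M_I| ∏_{i∈I} Aᵢ`;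
* Yu 2013, (6.16)–(6.18) (= the lattice half of Yu 2007, Prop. 3.1♣): independent `ℤ`-forms with
  `σ`-weighted `ℓ¹` row norms `Rᵢ` of controlled product.

Here (`exists_short_lattice_vectors`): for `ℚ`-independent integer rows `a₁, …, a_r ∈ ℤⁿ` (`r ≥ 1`)
and weights `Aₖ > 0` there are `ℝ`-independent `z₁, …, z_r ∈ ℤa₁ + ⋯ + ℤa_r` and an injective
selection `κ` of `r` coordinates with
`∏ₖ ‖zₖ‖_A ≤ r! · n^r · w(κ)`, `w(κ) = |det (a_{j, κ i})_{i,j}| · ∏ᵢ A_{κ i}` (spelled out in the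
statements; no definition is introduced) the MAXIMAL weighted
`r × r` minor (so `w(κ) ≤ ∑_I |det M_I| ∏_{i∈I} Aᵢ`, Nesterenko's (5.7)/(5.21) quantity).
Proof: Minkowski's second theorem (upper bound) for `ℤ^r` with the pulled-back norm
`N(y) = ‖∑ yᵢaᵢ‖_A` — the tree's `Dioph.exists_directional_system_prod_mul_volume_le`
[Evertse–Győry Thm 4.3.1] — gives `∏ N(vₖ) · vol{N < 1} ≤ 2^r`; and `vol{N < 1} ≥ 2^r/(r! n^r w(κ))`
because, writing `u_i = A_{κ i} (∑ⱼ yⱼ a_{j,κ i})`, Cramer's rule expresses every coordinate as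
`Aₖ (∑ⱼ yⱼ a_{jk}) = ∑ᵢ ρ_{ik} uᵢ` with `|ρ_{ik}| = w(κ[i ↦ k])/w(κ) ≤ 1` (maximality), so
`N(y) ≤ n ∑ᵢ |uᵢ|` and the cross-polytope `{∑|uᵢ| < 1/n}` (volume `2^r/(r! n^r)`, the tree's
`PrincipalLattice.volume_weighted_lt_one`) pulls back, through the map `y ↦ u` of determinant
`± w(κ)`, into `{N < 1}`.  (Nesterenko uses the inscribed ellipsoid and Cauchy–Binet instead, with
constant `Γ(1+r/2) π^{-r/2} n^{r/2}`; either constant is `2^{O(r log n)}` and is absorbed by the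
`2^{−(r+1)(n+23)}` room of his (5.22).)  Part II (the Cramer integer relation `m₀ b = ∑ mᵢ zᵢ` with
weighted Hadamard bounds, Nesterenko (2.9)–(2.12)) is a separate file.

References: [Nesterenko2003] Prop. 2.6, §5.2 (5.19)–(5.22); [Yu2013] §6 (6.16)–(6.19);
[EvertseGyory2015] Thm 4.3.1.
-/

noncomputable section

namespace Summit.ABC.StewartYu.LatticeLever

open MeasureTheory Module Finset Matrix
open Literature.NumberTheory.DiophantineGeometry.Dioph
open Summit.ABC.StewartYu.PrincipalLattice

variable {n r : ℕ}

/-- A selection with a non-zero minor is injective. [folklore] -/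
theorem injective_of_det_ne_zero (a : Fin r → Fin n → ℝ) {κ : Fin r → Fin n}
    (h : (Matrix.of fun i j => a j (κ i)).det ≠ 0) : Function.Injective κ := by
  intro i i' hii'
  by_contra hne
  apply h
  exact Matrix.det_zero_of_row_eq hne (by ext j; simp [hii'])

/-- **Cramer coefficients are `≤ 1` at the maximal weighted minor.** If `κ` maximises `w`, `w(κ) ≠ 0`,
then for every coordinate `k` and every `y`:
`Aₖ · |∑ⱼ yⱼ a_{jk}| ≤ ∑ᵢ A_{κ i} |∑ⱼ yⱼ a_{j, κ i}|`. [folklore] -/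
theorem weighted_coord_le_sum_of_max {A : Fin n → ℝ} (hA : ∀ k, 0 < A k)
    (a : Fin r → Fin n → ℝ) {κ : Fin r → Fin n}
    (hmax : ∀ κ' : Fin r → Fin n,
      |(Matrix.of fun i j => a j (κ' i)).det| * ∏ i, A (κ' i) ≤
        |(Matrix.of fun i j => a j (κ i)).det| * ∏ i, A (κ i)) (hκ : (Matrix.of fun i j => a j (κ i)).det ≠ 0)
    (y : Fin r → ℝ) (k : Fin n) :
    A k * |∑ j, y j * a j k| ≤ ∑ i, A (κ i) * |∑ j, y j * a j (κ i)| := by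
  classical
  set M₀ : Matrix (Fin r) (Fin r) ℝ := Matrix.of fun i j => a j (κ i) with hM₀
  set rowk : Fin r → ℝ := fun j => a j k with hrowk
  set e : Fin r → ℝ := Matrix.cramer M₀ᵀ rowk with he
  -- Cramer: `det M₀ · (rowk ⬝ y) = ∑ᵢ eᵢ (M₀ y)ᵢ`, `eᵢ = det (M₀ with row i ← rowk)`
  have hcr : M₀ᵀ *ᵥ e = M₀.det • rowk := by
    rw [he, Matrix.mulVec_cramer, Matrix.det_transpose]
  have hid : M₀.det * (∑ j, y j * a j k) = ∑ i, e i * (M₀ *ᵥ y) i := by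
    have h1 : (∑ j, y j * a j k) = rowk ⬝ᵥ y := by
      simp [hrowk, dotProduct, mul_comm]
    have h2 : ∑ i, e i * (M₀ *ᵥ y) i = e ⬝ᵥ (M₀ *ᵥ y) := rfl
    rw [h1, h2, Matrix.dotProduct_mulVec, ← Matrix.mulVec_transpose, hcr]
    simp [dotProduct, Finset.mul_sum, mul_assoc]
  have hei : ∀ i, e i = (Matrix.of fun i' j => a j (Function.update κ i k i')).det := by
    intro i
    rw [he, Matrix.cramer_transpose_apply]
    congr 1
    ext i' j
    by_cases h : i' = i
    · subst h; simp [Matrix.updateRow_self, hrowk]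
    · simp [Matrix.updateRow_ne h, hM₀, Function.update_of_ne h]
  -- weights: `A k · |e i| ≤ |det M₀| · A (κ i)` from maximality at `κ[i ↦ k]`
  have hw : ∀ i, A k * |e i| * ∏ i', A (κ i') ≤ |M₀.det| * A (κ i) * ∏ i', A (κ i') := by
    intro i
    have hm := hmax (Function.update κ i k)
    rw [← hei i] at hm
    -- `∏ A (update κ i k i') = (∏ A (κ i')) * A k / A (κ i)`
    have hprod : (∏ i', A (Function.update κ i k i')) * A (κ i) = (∏ i', A (κ i')) * A k := by
      rw [← Finset.mul_prod_erase univ (fun i' => A (Function.update κ i k i')) (mem_univ i),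
        ← Finset.mul_prod_erase univ (fun i' => A (κ i')) (mem_univ i)]
      simp only [Function.update_self]
      have : ∏ i' ∈ univ.erase i, A (Function.update κ i k i') = ∏ i' ∈ univ.erase i, A (κ i') :=
        Finset.prod_congr rfl fun i' hi' => by rw [Function.update_of_ne (ne_of_mem_erase hi')]
      rw [this]; ring
    have hAi : 0 < A (κ i) := hA _
    have := mul_le_mul_of_nonneg_right hm hAi.le
    calc A k * |e i| * ∏ i', A (κ i') = |e i| * ((∏ i', A (Function.update κ i k i')) * A (κ i)) := by
          rw [hprod]; ring
      _ = |e i| * (∏ i', A (Function.update κ i k i')) * A (κ i) := by ring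
      _ ≤ |M₀.det| * (∏ i', A (κ i')) * A (κ i) := this
      _ = |M₀.det| * A (κ i) * ∏ i', A (κ i') := by ring
  have hP : 0 < ∏ i', A (κ i') := Finset.prod_pos fun i _ => hA _
  have hw' : ∀ i, A k * |e i| ≤ |M₀.det| * A (κ i) := fun i =>
    le_of_mul_le_mul_right (hw i) hP
  have hdet : 0 < |M₀.det| := abs_pos.mpr hκ
  -- conclude
  have hmain : |M₀.det| * (A k * |∑ j, y j * a j k|) ≤
      |M₀.det| * ∑ i, A (κ i) * |∑ j, y j * a j (κ i)| := by
    have hMy : ∀ i, (M₀ *ᵥ y) i = ∑ j, y j * a j (κ i) := by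
      intro i; simp [Matrix.mulVec, dotProduct, hM₀, mul_comm]
    calc |M₀.det| * (A k * |∑ j, y j * a j k|) = A k * |M₀.det * ∑ j, y j * a j k| := by
          rw [abs_mul]; ring
      _ = A k * |∑ i, e i * (M₀ *ᵥ y) i| := by rw [hid]
      _ ≤ A k * ∑ i, |e i| * |(M₀ *ᵥ y) i| := by
          refine mul_le_mul_of_nonneg_left ?_ (hA k).le
          refine (Finset.abs_sum_le_sum_abs _ _).trans (le_of_eq ?_)
          exact Finset.sum_congr rfl fun i _ => abs_mul _ _
      _ = ∑ i, (A k * |e i|) * |(M₀ *ᵥ y) i| := by rw [Finset.mul_sum]; simp [mul_assoc]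
      _ ≤ ∑ i, (|M₀.det| * A (κ i)) * |(M₀ *ᵥ y) i| :=
          Finset.sum_le_sum fun i _ => mul_le_mul_of_nonneg_right (hw' i) (abs_nonneg _)
      _ = |M₀.det| * ∑ i, A (κ i) * |∑ j, y j * a j (κ i)| := by
          rw [Finset.mul_sum]
          exact Finset.sum_congr rfl fun i _ => by rw [hMy]; ring
  exact le_of_mul_le_mul_left hmain hdet

/-- **Short independent vectors in `ℤa₁ + ⋯ + ℤa_r` for the weighted `ℓ¹` norm** (Minkowski II in
basis coordinates + the maximal weighted minor; see the module docstring).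
[cite: Nesterenko2003, Prop 2.6 with (5.19)-(5.21)] [cite: EvertseGyory2015, Thm 4.3.1] -/
theorem exists_short_lattice_vectors (hr : 0 < r) {A : Fin n → ℝ} (hA : ∀ k, 0 < A k)
    (a : Fin r → Fin n → ℤ) (ha : LinearIndependent ℚ (fun i => fun k => (a i k : ℚ))) :
    ∃ (v : Fin r → Fin r → ℤ) (κ : Fin r → Fin n), Function.Injective κ ∧
      LinearIndependent ℝ (fun k i => (v k i : ℝ)) ∧
      (Matrix.of fun i j => (a j (κ i) : ℝ)).det ≠ 0 ∧
      (∀ κ' : Fin r → Fin n,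
        |(Matrix.of fun i j => (a j (κ' i) : ℝ)).det| * ∏ i, A (κ' i) ≤
          |(Matrix.of fun i j => (a j (κ i) : ℝ)).det| * ∏ i, A (κ i)) ∧
      ∏ k, (∑ l, A l * |((∑ i, v k i * a i l : ℤ) : ℝ)|) ≤
        (r.factorial : ℝ) * (n : ℝ) ^ r * (|(Matrix.of fun i j => (a j (κ i) : ℝ)).det| * ∏ i, A (κ i)) := by
  classical
  set aR : Fin r → Fin n → ℝ := fun j l => (a j l : ℝ) with haR
  -- a non-zero minor (over ℚ), hence the maximal weighted minor is non-zero
  set Aq : Matrix (Fin n) (Fin r) ℚ := Matrix.of fun l i => (a i l : ℚ) with hAq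
  have hcol : LinearIndependent ℚ Aq.col := ha
  obtain ⟨f, hf, hfdet⟩ := exists_rows_det_ne_zero Aq hcol
  have hfdetR : (Matrix.of fun i j => aR j (f i)).det ≠ 0 := by
    have hq : (Matrix.of fun i j => Aq (f i) j) = (Matrix.of fun i j => a j (f i)).map (Int.castRingHom ℚ) := by
      ext i j; rfl
    have hZ : (Matrix.of fun i j => a j (f i)).det ≠ 0 := by
      intro h0; apply hfdet
      rw [hq, ← RingHom.mapMatrix_apply, ← RingHom.map_det, h0, map_zero]
    have hR : (Matrix.of fun i j => aR j (f i)) = (Matrix.of fun i j => a j (f i)).map (Int.castRingHom ℝ) := by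
      ext i j; rfl
    rw [hR, ← RingHom.mapMatrix_apply, ← RingHom.map_det]
    intro h; apply hZ
    have : (((Matrix.of fun i j => a j (f i)).det : ℤ) : ℝ) = 0 := by simpa using h
    exact_mod_cast this
  haveI : Nonempty (Fin r → Fin n) := ⟨f⟩
  let w : (Fin r → Fin n) → ℝ := fun κ => |(Matrix.of fun i j => aR j (κ i)).det| * ∏ i, A (κ i)
  have w_def : ∀ κ, w κ = |(Matrix.of fun i j => aR j (κ i)).det| * ∏ i, A (κ i) := fun κ => rfl
  obtain ⟨κ, hκmax⟩ := Finite.exists_max w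
  have hwf : 0 < w f :=
    mul_pos (abs_pos.mpr hfdetR) (Finset.prod_pos fun i _ => hA _)
  have hwκ : 0 < w κ := lt_of_lt_of_le hwf (hκmax f)
  have hκdet : (Matrix.of fun i j => aR j (κ i)).det ≠ 0 := by
    intro h0; rw [w_def, h0, abs_zero, zero_mul] at hwκ; exact lt_irrefl _ hwκ
  have hκinj : Function.Injective κ := injective_of_det_ne_zero aR hκdet
  have hrn : r ≤ n := by simpa using Fintype.card_le_of_injective κ hκinj
  have hn : 0 < n := lt_of_lt_of_le hr hrn
  have hnR : (0 : ℝ) < n := by exact_mod_cast hn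
  -- the maps `T y = ∑ yⱼ aⱼ ∈ ℝⁿ` and `T₂ y = (A_{κ i} (T y)_{κ i})ᵢ ∈ ℝ^r`
  set M₀ : Matrix (Fin r) (Fin r) ℝ := Matrix.of fun i j => aR j (κ i) with hM₀
  set C : Matrix (Fin r) (Fin r) ℝ := Matrix.of fun i j => A (κ i) * M₀ i j with hC
  have hCdet : C.det = (∏ i, A (κ i)) * M₀.det := by
    rw [hC]; exact Matrix.det_mul_column (fun i => A (κ i)) M₀
  have hCdet' : |C.det| = w κ := by
    rw [hCdet, abs_mul, abs_of_pos (Finset.prod_pos fun i _ => hA _), w_def, mul_comm]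
  have hCdet0 : C.det ≠ 0 := by rw [← abs_ne_zero, hCdet']; exact hwκ.ne'
  set T : (Fin r → ℝ) →ₗ[ℝ] (Fin n → ℝ) := Matrix.toLin' (Matrix.of fun l j => aR j l) with hT
  have hTapply : ∀ y l, T y l = ∑ j, y j * aR j l := by
    intro y l; simp [hT, Matrix.toLin'_apply, Matrix.mulVec, dotProduct, mul_comm]
  set T₂ : (Fin r → ℝ) →ₗ[ℝ] (Fin r → ℝ) := Matrix.toLin' C with hT₂
  have hT₂apply : ∀ y i, T₂ y i = A (κ i) * ∑ j, y j * aR j (κ i) := by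
    intro y i
    simp [hT₂, Matrix.toLin'_apply, Matrix.mulVec, dotProduct, hC, hM₀, Finset.mul_sum, mul_comm,
      mul_left_comm]
  have hT₂det : LinearMap.det T₂ = C.det := by rw [hT₂, LinearMap.det_toLin']
  -- the pulled-back weighted norm `N y = ∑ₗ Aₗ |(T y)ₗ|`
  obtain ⟨F, hF, hF0⟩ := exists_seminorm_weighted A hA
  let N : Seminorm ℝ (Fin r → ℝ) := F.comp T
  have N_apply : ∀ y, N y = ∑ l, A l * |∑ j, y j * aR j l| := by
    intro y; show F (T y) = _; rw [hF]; simp only [hTapply]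
  -- `N y ≤ n · ∑ᵢ |T₂ y i|`
  have hNle : ∀ y, N y ≤ n * ∑ i, |T₂ y i| := by
    intro y
    have hk : ∀ l, A l * |∑ j, y j * aR j l| ≤ ∑ i, |T₂ y i| := by
      intro l
      calc A l * |∑ j, y j * aR j l| ≤ ∑ i, A (κ i) * |∑ j, y j * aR j (κ i)| :=
            weighted_coord_le_sum_of_max hA aR (fun κ' => hκmax κ') hκdet y l
        _ = ∑ i, |T₂ y i| := Finset.sum_congr rfl fun i _ => by
            rw [hT₂apply, abs_mul, abs_of_pos (hA _)]
    calc N y = ∑ l, A l * |∑ j, y j * aR j l| := N_apply y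
      _ ≤ ∑ l : Fin n, ∑ i, |T₂ y i| := Finset.sum_le_sum fun l _ => hk l
      _ = n * ∑ i, |T₂ y i| := by rw [Finset.sum_const, Finset.card_univ, Fintype.card_fin, nsmul_eq_mul]
  -- definiteness of `N`
  have hN : ∀ y, N y = 0 → y = 0 := by
    intro y hy
    have h0 : ∑ i, |T₂ y i| = 0 := by
      have h1 : 0 ≤ ∑ i, |T₂ y i| := Finset.sum_nonneg fun i _ => abs_nonneg _
      have h2 := hNle y
      rw [hy] at h2
      -- from `0 ≤ n * s` we cannot conclude; use injectivity of `T₂` via `N y = 0 ⇒ T y = 0`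
      have hTy : T y = 0 := hF0 _ hy
      have : ∀ i, T₂ y i = 0 := by
        intro i; rw [hT₂apply]
        have := congr_fun hTy (κ i)
        rw [hTapply] at this
        simp [this]
      simp [this]
    have hT₂y : T₂ y = 0 := by
      funext i
      have := (Finset.sum_eq_zero_iff_of_nonneg fun i _ => abs_nonneg (T₂ y i)).mp h0 i (mem_univ i)
      exact abs_eq_zero.mp this
    have hinj : Function.Injective T₂ := by
      rw [hT₂]
      exact Matrix.mulVec_injective_iff_isUnit.mpr
        ((Matrix.isUnit_iff_isUnit_det _).mpr (isUnit_iff_ne_zero.mpr hCdet0))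
    exact hinj (by rw [hT₂y, map_zero])
  -- Minkowski II for `ℤ^r` with the norm `N`
  obtain ⟨v, hli, -, -, hvol⟩ := exists_directional_system_prod_mul_volume_le hr N hN
  -- volume lower bound: `{N < 1} ⊇ T₂ ⁻¹' {u : ∑ n|uᵢ| < 1}`
  have hsub : T₂ ⁻¹' {u : Fin r → ℝ | ∑ i, (n : ℝ) * |u i| < 1} ⊆ {y | N y < 1} := by
    intro y hy
    simp only [Set.mem_preimage, Set.mem_setOf_eq] at hy ⊢
    rw [← Finset.mul_sum] at hy
    exact lt_of_le_of_lt (hNle y) hy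
  have hvolS : volume {u : Fin r → ℝ | ∑ i, (n : ℝ) * |u i| < 1} =
      ENNReal.ofReal (2 ^ r / (r.factorial * ∏ _i : Fin r, (n : ℝ))) :=
    volume_weighted_lt_one (fun _ => (n : ℝ)) (fun _ => hnR)
  have hvolN : ENNReal.ofReal (|C.det|⁻¹ * (2 ^ r / (r.factorial * (n : ℝ) ^ r))) ≤
      volume {y : Fin r → ℝ | N y < 1} := by
    have h := MeasureTheory.measure_mono (μ := volume) hsub
    rw [MeasureTheory.Measure.addHaar_preimage_linearMap volume (by rw [hT₂det]; exact hCdet0),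
      hT₂det, hvolS, ← ENNReal.ofReal_mul (abs_nonneg _), abs_inv] at h
    simpa [Finset.prod_const, Finset.card_univ, Fintype.card_fin] using h
  -- combine: `∏ N(v_k) ≤ r! n^r w(κ)`
  set P : ℝ := ∏ k, N (fun i => (v k i : ℝ)) with hP
  have hP0 : 0 ≤ P := Finset.prod_nonneg fun k _ => apply_nonneg _ _
  have hμ : 0 < |C.det| := abs_pos.mpr hCdet0
  have hfac : (0 : ℝ) < r.factorial := by exact_mod_cast Nat.factorial_pos r
  have hPle : P ≤ (r.factorial : ℝ) * (n : ℝ) ^ r * |C.det| := by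
    have h1 : ENNReal.ofReal P * ENNReal.ofReal (|C.det|⁻¹ * (2 ^ r / (r.factorial * (n : ℝ) ^ r))) ≤
        2 ^ r := le_trans (mul_le_mul' le_rfl hvolN) hvol
    have h2r : (2 : ENNReal) ^ r = ENNReal.ofReal ((2 : ℝ) ^ r) := by
      rw [ENNReal.ofReal_pow (by norm_num), ENNReal.ofReal_ofNat]
    rw [h2r, ← ENNReal.ofReal_mul hP0, ENNReal.ofReal_le_ofReal_iff (by positivity)] at h1
    -- `h1 : P * (|det|⁻¹ * (2^r / (r! n^r))) ≤ 2^r`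
    have h3 : P * (2 : ℝ) ^ r ≤ (r.factorial : ℝ) * (n : ℝ) ^ r * |C.det| * 2 ^ r := by
      have := mul_le_mul_of_nonneg_left h1
        (show (0 : ℝ) ≤ (r.factorial : ℝ) * (n : ℝ) ^ r * |C.det| by positivity)
      calc P * (2 : ℝ) ^ r
          = (r.factorial : ℝ) * (n : ℝ) ^ r * |C.det| *
              (P * (|C.det|⁻¹ * (2 ^ r / (r.factorial * (n : ℝ) ^ r)))) := by
            field_simp
        _ ≤ (r.factorial : ℝ) * (n : ℝ) ^ r * |C.det| * 2 ^ r := this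
    exact le_of_mul_le_mul_right h3 (by positivity)
  -- read off
  have hNv : ∀ k, (∑ l, A l * |((∑ i, v k i * a i l : ℤ) : ℝ)|) = N (fun i => (v k i : ℝ)) := by
    intro k
    rw [N_apply]
    refine Finset.sum_congr rfl fun l _ => ?_
    congr 2
    push_cast [haR]
    rfl
  refine ⟨v, κ, hκinj, hli, hκdet, fun κ' => hκmax κ', ?_⟩
  calc ∏ k, (∑ l, A l * |((∑ i, v k i * a i l : ℤ) : ℝ)|) = P := by
        rw [hP]; exact Finset.prod_congr rfl fun k _ => hNv k
    _ ≤ (r.factorial : ℝ) * (n : ℝ) ^ r * |C.det| := hPle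
    _ = (r.factorial : ℝ) * (n : ℝ) ^ r * w κ := by rw [hCdet']

end Summit.ABC.StewartYu.LatticeLever

end
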